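import Mathlib.Topology.Algebra.FilterBasis
import Literature.AnabelianGeometry.SemiGraphs.TemperedGroups

/-!
# Extensions of tempered groups, I: the group topology glued from a basis of subgroups
# ([SemiAnbd] §0 p. 5 outer semi-direct products, §3 Def 3.1 (i), §5 Prop 5.2 (iv))

Mochizuki, *Semi-graphs of anabelioids*, Publ. RIMS **42** (2006) 221–322, §0 p. 5 ("outer
semi-direct product" `G ⋊^out J`, "a natural exact sequence `1 → G → G ⋊^out J → J → 1`"),
Def 3.1 (i) p. 33 (tempered groups) and Prop 5.2 (iii)/(iv) p. 64 ("natural exact sequences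
`1 → Π^temp_𝔾 → Π^temp_𝔊 → Π_A → 1`", where `Π^temp_𝔊 := π₁^temp(B^temp(𝔊))` carries the topology of
the connected temperoid `B^temp(𝔊)`) [cite: MochizukiSemiAnbd2006, Prop 5.2 (iv), p. 64].

PROOF-ONLY ENGINE (no definitions, no named facts; row T54-B-top of the producer debt T54-B =
`HOME/plan/GAP-LEDGER.md` G-w4d053-1, sub-DAG `plan/L3/SUBDAG-SemiAnbd-Thm54.md`; seat abc-iut-L3-d2).
In the cell's group-theoretic model, the arithmetic tempered fundamental group `Π^temp_𝔊` is an
ABSTRACT extension `1 → Π → E → Π_A → 1` of the profinite `Π_A = π̂₁(A)` by the tempered, temp-slim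
`Π = π₁^temp(𝒢)` (the outer semi-direct product `Π ⋊^out Π_A` of §0, `NotationsConventions.lean`,
exactness `outerSemidirectProduct_exact_holds`).  Print's topology on `Π^temp_𝔊` — open subgroups =
stabilisers of points of ARITHMETIC tempered coverings (Prop 5.2 (i)(ii)) — is not a function of
`(Π, Π_A)` and the outer action alone; the arithmetic side supplies a family `𝓜` of subgroups of `E`
(stabilisers / kernels of the arithmetic tree levels).  This file proves, independently of how `E` and
`𝓜` are produced:

* `exists_groupTopology_of_subgroupBasis(_of_normal)` — a nonempty, downward directed family `𝓜` of
  subgroups stable under conjugation (e.g. with cofinal normal members) is a basis of neighbourhoods of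
  `1` of a group topology on `E` (Mathlib's `GroupFilterBasis`);
* exactness bookkeeping (`coe_iota_eq_iff`, `exists_coe_iota_eq`) and `countable_quotient`: `E ⧸ N` is
  countable when `Π ⧸ ι⁻¹N` and `Π_A ⧸ aug N` are ([SemiAnbd] Rmk 3.1.2);

and, for ANY group topology on `E` in which `𝓜` is a basis of neighbourhoods of `1`:

* `isOpen_of_mem` / `isOpen_of_le` / `isOpen_iff_exists_le` — the open subgroups are those above a
  member of `𝓜` (consumers' `ArithLevelData.isOpen_ker`);
* `continuous_iota`, `isEmbedding_iota`, `isCompact_image_iota`, `isClosed_range_iota` — `ι` is a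
  closed embedding when its traces `ι⁻¹(M)` are open and cofinal in `𝓝 1` (so the compact verticial /
  edge-like subgroups of `π₁^temp(𝒢)` stay compact in `E`, Rmk 5.3.1);
* `continuous_aug`, `isOpenMap_aug` — `aug` is a continuous open map when the images `aug(M)` are open
  and cofinal in `𝓝 1`; `isClosed_singleton_one_of_isTempered` — tempered groups are `T₁`.

Temperedness of `E` is the sequel `TemperedExtensionTempered.lean`.  Nothing here refers to the IUT
corpus; no side is taken on any disputed claim.
-/

namespace Literature.AnabelianGeometry.SemiGraphs

namespace TemperedExtension

open Topology Filter

universe u v w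

/-! ### A group topology from a basis of subgroups -/

section Basis

variable {E : Type w} [Group E]

/-- **A downward directed family of subgroups with cofinal normal members is a basis of
neighbourhoods of `1` of a group topology** (Bourbaki TG III §1.2; Mathlib `GroupFilterBasis`).
Used to topologise the outer semi-direct product model of `Π^temp_𝔊` ([SemiAnbd] §0 p. 5,
Prop 5.2 (iv) p. 64) by the stabilisers of the arithmetic tempered coverings.
[cite: MochizukiSemiAnbd2006, Prop 5.2 (iv), p. 64] -/
theorem exists_groupTopology_of_subgroupBasis (𝓜 : Set (Subgroup E)) (hne : 𝓜.Nonempty)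
    (hdir : ∀ M₁ ∈ 𝓜, ∀ M₂ ∈ 𝓜, ∃ M₃ ∈ 𝓜, M₃ ≤ M₁ ⊓ M₂)
    (hconj : ∀ (e : E), ∀ M ∈ 𝓜, ∃ M' ∈ 𝓜, ∀ x ∈ M', e * x * e⁻¹ ∈ M) :
    ∃ τ : TopologicalSpace E, @IsTopologicalGroup E τ _ ∧
      (@nhds E τ 1).HasBasis (fun M : Subgroup E => M ∈ 𝓜) (fun M => (M : Set E)) := by
  classical
  let B : GroupFilterBasis E :=
    { sets := (fun M : Subgroup E => (M : Set E)) '' 𝓜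
      nonempty := hne.image _
      inter_sets := by
        rintro _ _ ⟨M₁, hM₁, rfl⟩ ⟨M₂, hM₂, rfl⟩
        obtain ⟨M₃, hM₃, hle⟩ := hdir M₁ hM₁ M₂ hM₂
        exact ⟨M₃, ⟨M₃, hM₃, rfl⟩, fun x hx => ⟨(hle hx).1, (hle hx).2⟩⟩
      one' := by
        rintro _ ⟨M, -, rfl⟩
        exact M.one_mem
      mul' := by
        rintro _ ⟨M, hM, rfl⟩
        refine ⟨M, ⟨M, hM, rfl⟩, ?_⟩
        rintro _ ⟨x, hx, y, hy, rfl⟩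
        exact M.mul_mem hx hy
      inv' := by
        rintro _ ⟨M, hM, rfl⟩
        exact ⟨M, ⟨M, hM, rfl⟩, fun x hx => M.inv_mem hx⟩
      conj' := by
        rintro e _ ⟨M, hM, rfl⟩
        obtain ⟨M', hM', h⟩ := hconj e M hM
        exact ⟨M', ⟨M', hM', rfl⟩, fun x hx => h x hx⟩ }
  refine ⟨B.topology, B.isTopologicalGroup, ?_⟩
  refine ⟨fun U => ?_⟩
  rw [B.nhds_one_hasBasis.mem_iff]
  constructor
  · rintro ⟨_, ⟨M, hM, rfl⟩, hMU⟩
    exact ⟨M, hM, hMU⟩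
  · rintro ⟨M, hM, hMU⟩
    exact ⟨M, ⟨M, hM, rfl⟩, hMU⟩

/-- Variant with the conjugation condition DERIVED from cofinality of the normal members.
[cite: MochizukiSemiAnbd2006, Prop 5.2 (iv), p. 64] -/
theorem exists_groupTopology_of_subgroupBasis_of_normal (𝓜 : Set (Subgroup E)) (hne : 𝓜.Nonempty)
    (hdir : ∀ M₁ ∈ 𝓜, ∀ M₂ ∈ 𝓜, ∃ M₃ ∈ 𝓜, M₃ ≤ M₁ ⊓ M₂)
    (hnormal : ∀ M ∈ 𝓜, ∃ N ∈ 𝓜, N ≤ M ∧ N.Normal) :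
    ∃ τ : TopologicalSpace E, @IsTopologicalGroup E τ _ ∧
      (@nhds E τ 1).HasBasis (fun M : Subgroup E => M ∈ 𝓜) (fun M => (M : Set E)) := by
  refine exists_groupTopology_of_subgroupBasis 𝓜 hne hdir fun e M hM => ?_
  obtain ⟨N, hN, hNM, hNn⟩ := hnormal M hM
  exact ⟨N, hN, fun x hx => hNM (hNn.conj_mem x hx e)⟩

end Basis

/-! ### Exactness bookkeeping for an abstract extension `1 → Π → E → Π_A → 1` -/

section Algebra

variable {P : Type u} [Group P] {A : Type v} [Group A] {E : Type w} [Group E]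
  (ι : P →* E) (aug : E →* A)

/-- Cosets of `ι(Π)` modulo a normal subgroup `N`: `ι p ≡ ι p' (mod N)` iff `p ≡ p' (mod ι⁻¹N)`.
[cite: MochizukiSemiAnbd2006, Prop 5.2 (iv), p. 64] -/
theorem coe_iota_eq_iff (N : Subgroup E) [N.Normal] (p p' : P) :
    ((ι p : E) : E ⧸ N) = (ι p' : E) ↔ (p : P ⧸ N.comap ι) = p' := by
  rw [QuotientGroup.eq, QuotientGroup.eq, Subgroup.mem_comap, map_mul, map_inv]

/-- Exactness at `E`, element form: an element with trivial augmentation is in the image of `ι`.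
[cite: MochizukiSemiAnbd2006, §0, p. 5] -/
theorem exists_eq_iota_of_aug_eq_one (hex : ι.range = aug.ker) {e : E} (he : aug e = 1) :
    ∃ p : P, ι p = e := by
  have : e ∈ ι.range := by rw [hex]; exact he
  exact this

/-- Exactness at `E`, composite form: `aug ∘ ι = 1`. [cite: MochizukiSemiAnbd2006, §0, p. 5] -/
theorem aug_iota (hex : ι.range = aug.ker) (p : P) : aug (ι p) = 1 := by
  have : ι p ∈ aug.ker := by rw [← hex]; exact ⟨p, rfl⟩
  exact this

/-- Exactness modulo a normal subgroup `N`: a coset of `E ⧸ N` whose augmentation lies in `aug(N)`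
is the coset of an element of `ι(Π)`. [cite: MochizukiSemiAnbd2006, Prop 5.2 (iv), p. 64] -/
theorem exists_coe_iota_eq (hex : ι.range = aug.ker) (N : Subgroup E) [N.Normal] (e : E)
    (he : aug e ∈ N.map aug) : ∃ p : P, ((ι p : E) : E ⧸ N) = e := by
  obtain ⟨n, hn, hne⟩ := he
  obtain ⟨p, hp⟩ := exists_eq_iota_of_aug_eq_one ι aug hex (e := e * n⁻¹)
    (by rw [map_mul, map_inv, hne, mul_inv_cancel])
  refine ⟨p, ?_⟩
  rw [hp, QuotientGroup.eq]
  simpa using hn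

/-- **Countable index is inherited by the extension**: if `Π ⧸ ι⁻¹N` and `Π_A ⧸ aug(N)` are countable
then so is `E ⧸ N` (the fibres of `E ⧸ N → Π_A ⧸ aug N` are translates of the image of `Π ⧸ ι⁻¹N`).
[cite: MochizukiSemiAnbd2006, Rmk 3.1.2, p. 33] -/
theorem countable_quotient (hex : ι.range = aug.ker) (N : Subgroup E) [N.Normal]
    (hP : Countable (P ⧸ N.comap ι)) (hA : Countable (A ⧸ N.map aug)) : Countable (E ⧸ N) := by
  classical
  -- the comparison map `E ⧸ N → Π_A ⧸ aug N` on left cosets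
  let q : E ⧸ N → A ⧸ N.map aug := Quotient.map' aug fun a b h => by
    rw [QuotientGroup.leftRel_apply] at h ⊢
    rw [← map_inv, ← map_mul]
    exact ⟨_, h, rfl⟩
  have hq : ∀ e : E, q (e : E ⧸ N) = (aug e : A ⧸ N.map aug) := fun e => rfl
  -- the image of `Π ⧸ ι⁻¹N` in `E ⧸ N`
  let ιbar : P ⧸ N.comap ι → E ⧸ N := fun t => Quotient.liftOn' t (fun p => ((ι p : E) : E ⧸ N))
    fun a b h => by
      rw [coe_iota_eq_iff]
      exact Quotient.sound' h
  have hιbar : ∀ p : P, ιbar (p : P ⧸ N.comap ι) = ((ι p : E) : E ⧸ N) := fun p => rfl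
  have hcount : (Set.range ιbar).Countable := Set.countable_range ιbar
  -- every fibre of `q` is a translate of `range ιbar`
  have hfibre : ∀ x y : E ⧸ N, q x = q y → y ∈ (fun t => x * t) '' Set.range ιbar := by
    intro x y hxy
    obtain ⟨a, rfl⟩ := QuotientGroup.mk_surjective x
    obtain ⟨b, rfl⟩ := QuotientGroup.mk_surjective y
    rw [hq, hq, QuotientGroup.eq] at hxy
    obtain ⟨p, hp⟩ := exists_coe_iota_eq ι aug hex N (a⁻¹ * b)
      (by rw [map_mul, map_inv]; exact hxy)
    refine ⟨(ι p : E), ⟨(p : P ⧸ N.comap ι), hιbar p⟩, ?_⟩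
    change ((a : E) : E ⧸ N) * ((ι p : E) : E ⧸ N) = (b : E ⧸ N)
    rw [hp, ← QuotientGroup.mk_mul, mul_inv_cancel_left]
  -- cover `E ⧸ N` by countably many countable fibres
  have hcover : (Set.univ : Set (E ⧸ N)) ⊆
      ⋃ b : A ⧸ N.map aug, {y : E ⧸ N | q y = b} := fun y _ => Set.mem_iUnion.mpr ⟨q y, rfl⟩
  have hfib : ∀ b : A ⧸ N.map aug, ({y : E ⧸ N | q y = b} : Set (E ⧸ N)).Countable := by
    intro b
    by_cases h : ∃ x : E ⧸ N, q x = b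
    · obtain ⟨x, hx⟩ := h
      exact ((hcount.image fun t => x * t).mono fun y hy => hfibre x y (hx.trans hy.symm))
    · have : ({y : E ⧸ N | q y = b} : Set (E ⧸ N)) = ∅ :=
        Set.eq_empty_iff_forall_notMem.mpr fun y hy => h ⟨y, hy⟩
      rw [this]
      exact Set.countable_empty
  rw [← Set.countable_univ_iff]
  exact (Set.countable_iUnion hfib).mono hcover

end Algebra

/-! ### Consequences for any group topology with basis `𝓜` -/

section Consequences

variable {P : Type u} [Group P] [TopologicalSpace P] [IsTopologicalGroup P]
  {A : Type v} [Group A] [TopologicalSpace A] [IsTopologicalGroup A]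
  {E : Type w} [Group E] [TopologicalSpace E] [IsTopologicalGroup E]
  (ι : P →* E) (aug : E →* A) {𝓜 : Set (Subgroup E)}
  (hb : (𝓝 (1 : E)).HasBasis (fun M : Subgroup E => M ∈ 𝓜) (fun M => (M : Set E)))

include hb

/-- Members of the basis are open subgroups. [cite: MochizukiSemiAnbd2006, Prop 5.2 (iv), p. 64] -/
theorem isOpen_of_mem {M : Subgroup E} (hM : M ∈ 𝓜) : IsOpen (M : Set E) :=
  M.isOpen_of_mem_nhds (g := 1) (hb.mem_of_mem hM)

/-- Every subgroup containing a member of the basis is open (e.g. the kernel of the action on an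
arithmetic tree level, `ArithLevelData.isOpen_ker`). [cite: MochizukiSemiAnbd2006, Prop 5.2 (iv), p. 64] -/
theorem isOpen_of_le {M K : Subgroup E} (hM : M ∈ 𝓜) (h : M ≤ K) : IsOpen (K : Set E) :=
  Subgroup.isOpen_mono h (isOpen_of_mem hb hM)

/-- A subgroup is open iff it contains a member of the basis.
[cite: MochizukiSemiAnbd2006, Prop 5.2 (iv), p. 64] -/
theorem isOpen_iff_exists_le (K : Subgroup E) : IsOpen (K : Set E) ↔ ∃ M ∈ 𝓜, M ≤ K := by
  constructor
  · intro hK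
    obtain ⟨M, hM, hMK⟩ := hb.mem_iff.mp (hK.mem_nhds K.one_mem)
    exact ⟨M, hM, fun x hx => hMK hx⟩
  · rintro ⟨M, hM, hMK⟩
    exact isOpen_of_le hb hM hMK

/-- `ι : Π → E` is continuous as soon as the traces `ι⁻¹(M)`, `M ∈ 𝓜`, are open in `Π`.
[cite: MochizukiSemiAnbd2006, Prop 5.2 (iv), p. 64] -/
theorem continuous_iota (hT1 : ∀ M ∈ 𝓜, IsOpen ((M.comap ι : Subgroup P) : Set P)) :
    Continuous ι := by
  apply continuous_of_continuousAt_one ι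
  rw [ContinuousAt, map_one, hb.tendsto_right_iff]
  intro M hM
  filter_upwards [(hT1 M hM).mem_nhds (M.comap ι).one_mem] with x hx
  exact hx

/-- `ι : Π → E` is a topological embedding as soon as it is injective, its traces are open and
cofinal in the neighbourhoods of `1` of `Π`. [cite: MochizukiSemiAnbd2006, Prop 5.2 (iv), p. 64] -/
theorem isEmbedding_iota (hι : Function.Injective ι)
    (hT1 : ∀ M ∈ 𝓜, IsOpen ((M.comap ι : Subgroup P) : Set P))
    (hT3 : ∀ U ∈ 𝓝 (1 : P), ∃ M ∈ 𝓜, ((M.comap ι : Subgroup P) : Set P) ⊆ U) :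
    IsEmbedding ι := by
  refine ⟨?_, hι⟩
  rw [IsTopologicalGroup.isInducing_iff_nhds_one]
  apply le_antisymm
  · have h := (continuous_iota ι hb hT1).tendsto (1 : P)
    rw [map_one] at h
    exact h.le_comap
  · intro U hU
    obtain ⟨M, hM, hMU⟩ := hT3 U hU
    exact Filter.mem_comap.mpr ⟨M, hb.mem_of_mem hM, hMU⟩

/-- Compact subsets of `Π` (e.g. verticial and edge-like subgroups of `π₁^temp(𝒢)`, Thm 3.7) have
compact image in `E`. [cite: MochizukiSemiAnbd2006, Rmk 5.3.1, p. 65] -/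
theorem isCompact_image_iota (hT1 : ∀ M ∈ 𝓜, IsOpen ((M.comap ι : Subgroup P) : Set P))
    {K : Set P} (hK : IsCompact K) : IsCompact (ι '' K) :=
  hK.image (continuous_iota ι hb hT1)

/-- `aug : E → Π_A` is continuous as soon as the images `aug(M)`, `M ∈ 𝓜`, are cofinal in the
neighbourhoods of `1` of `Π_A`. [cite: MochizukiSemiAnbd2006, Prop 5.2 (iv), p. 64] -/
theorem continuous_aug (hT5 : ∀ V ∈ 𝓝 (1 : A), ∃ M ∈ 𝓜, ((M.map aug : Subgroup A) : Set A) ⊆ V) :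
    Continuous aug := by
  apply continuous_of_continuousAt_one aug
  rw [ContinuousAt, map_one]
  intro V hV
  obtain ⟨M, hM, hMV⟩ := hT5 V hV
  rw [Filter.mem_map]
  filter_upwards [hb.mem_of_mem hM] with x hx
  exact hMV ⟨x, hx, rfl⟩

/-- `aug : E → Π_A` is an open map as soon as the images `aug(M)`, `M ∈ 𝓜`, are open in `Π_A`.
[cite: MochizukiSemiAnbd2006, Prop 5.2 (iv), p. 64] -/
theorem isOpenMap_aug (hT1 : ∀ M ∈ 𝓜, IsOpen ((M.map aug : Subgroup A) : Set A)) :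
    IsOpenMap aug := by
  rw [IsTopologicalGroup.isOpenMap_iff_nhds_one]
  intro S hS
  rw [Filter.mem_map] at hS
  obtain ⟨M, hM, hMS⟩ := hb.mem_iff.mp hS
  apply Filter.mem_of_superset ((hT1 M hM).mem_nhds (M.map aug).one_mem)
  rintro _ ⟨x, hx, rfl⟩
  exact hMS hx

omit hb [TopologicalSpace P] [IsTopologicalGroup P] [IsTopologicalGroup A] [IsTopologicalGroup E] in
/-- The image of `ι` is closed when it is the kernel of the continuous `aug` and `Π_A` is `T₁`
(e.g. tempered, `isClosed_singleton_one_of_isTempered`). [cite: MochizukiSemiAnbd2006, Prop 5.2 (iv), p. 64] -/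
theorem isClosed_range_iota (hex : ι.range = aug.ker) (haug : Continuous aug)
    (hA : IsClosed ({1} : Set A)) : IsClosed (Set.range ι) := by
  have : Set.range ι = aug ⁻¹' {1} := by
    ext x
    constructor
    · rintro ⟨p, rfl⟩
      have : ι p ∈ aug.ker := by rw [← hex]; exact ⟨p, rfl⟩
      exact this
    · intro hx
      have hx' : x ∈ ι.range := by rw [hex]; exact hx
      obtain ⟨p, hp⟩ := hx'
      exact ⟨p, hp⟩
  rw [this]
  exact hA.preimage haug

omit hb [TopologicalSpace P] [IsTopologicalGroup P] [TopologicalSpace E] [IsTopologicalGroup E] in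
/-- In a tempered group the identity is closed (open normal subgroups separate points), hence the
group is `T₁`. [cite: MochizukiSemiAnbd2006, Def 3.1 (i), p. 33] -/
theorem isClosed_singleton_one_of_isTempered (hA : IsTempered A) : IsClosed ({1} : Set A) := by
  rw [← isOpen_compl_iff, isOpen_iff_mem_nhds]
  intro a ha
  have ha' : a ≠ 1 := fun h => ha (Set.mem_singleton_iff.mpr h)
  obtain ⟨N, hN⟩ := hA.separated a ha'
  have hopen : IsOpen ((fun x => a⁻¹ * x) ⁻¹' (N : Set A)) :=
    N.toOpenSubgroup.isOpen.preimage (by fun_prop)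
  refine Filter.mem_of_superset (hopen.mem_nhds ?_) ?_
  · change a⁻¹ * a ∈ (N : Set A)
    rw [inv_mul_cancel, SetLike.mem_coe]
    exact one_mem N
  · intro x hx h1
    have hx1 : x = 1 := h1
    subst hx1
    apply hN
    have hx' : a⁻¹ * 1 ∈ (N : Set A) := hx
    rw [mul_one, SetLike.mem_coe] at hx'
    rw [SetLike.mem_coe]
    simpa using inv_mem hx'

end Consequences

end TemperedExtension

end Literature.AnabelianGeometry.SemiGraphs
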